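import Literature.Analysis.FluidPDE.HardSphereWindowEnumeration
import Literature.Analysis.FluidPDE.HardSphereFlowJointMeasurable
import Literature.Analysis.FluidPDE.LoadedCollisionRecordMeasurable
import HarnessLib

/-!
# The `n`-th collision time of a particle along a hard-sphere flow is measurable in the initial datum

For an abstract hard-sphere flow `Φ : HardSphereFlow G ε N` (Alexander's theorem as a hypothesis
structure: each `Φ_t` measurable, good orbits are hard-sphere trajectories) the time
`Φ.nthCollisionTimeOf i n z` of the `n`-th collision of particle `i` along the orbit of `z` is a
measurable function of `z` on the good set — implicit whenever collision-indexed functionals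
(collision sums stopped at the `K`-th collision of a particle, marks of the `n`-th collision, coarse
collision filtrations) are integrated against a law on phase space (Gallagher–Saint-Raymond–Texier
2013 §4.1–4.2; Cercignani–Illner–Pulvirenti 1994 App. 4.A).  Proof: the collision times of `i`
along a good orbit are the zero set of the participation gauge of the orbit (`contactGauge`,
continuous in time since positions are, measurable in the datum since `Φ_t` is), so the
hitting-time lemma `measurable_nextTimeAfter_setOf_eq_zero` of `LoadedCollisionRecordMeasurable`
applies inductively (that file proves the same for LOADED-sphere flows; the route file
`Theorems/OneFlightGossipEngineOneFlightLayeredChaosCollisionTime` of the hydrodynamic-limit problem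
has a problem-side torus copy by a different argument).

* `HardSphereFlow.measurable_nthCollisionTimeOf_comp_subtype` — any geometry with continuous
  separation distance and measurable separation map (`ℝ^d`, `𝕋^d`);
* `HardSphereFlow.measurable_flow_nthCollisionTimeOf_comp_subtype` — the configuration at that time
  (joint measurability of the flow on `good × ℝ`, continuous translations);
* `HardSphereFlow.measurableSet_lt_ncard_collisionTimesOf_window` — the event "`i` has at least
  `n + 1` collisions in `(0, h]`" is measurable on the good set (chain form,
  `HardSphereFlow.lt_ncard_collisionTimesOf_window_iff_chain`);
* `HardSphereFlow.measurable_sum_ite_lt_ncard_comp_subtype` — hence collision sums of a measurable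
  per-particle functional over the first `min(Jᵢ, K + 1)` collisions of each particle are measurable
  on the good set; torus specialisation `…_torus`.

## References

* I. Gallagher, L. Saint-Raymond, B. Texier, *From Newton to Boltzmann* (2013), §4.1–4.2.
* C. Cercignani, R. Illner, M. Pulvirenti, *The Mathematical Theory of Dilute Gases* (1994), App. 4.A.
-/

open Set Function MeasureTheory Filter
open scoped Topology

namespace Literature.Analysis.FluidPDE

noncomputable section

section Kinetic

variable {d : Type*} [Fintype d] {X : Type*} [MeasureSpace X] [TopologicalSpace X] {N : ℕ}
  {G : Geometry d X} {ε : ℝ}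

namespace HardSphereFlow

variable (Φ : HardSphereFlow G ε N)

/-- Along a good orbit the collision times of `i` are the zeros of the participation gauge of the
orbit's positions. [folklore] -/
theorem collisionTimesOf_eq_setOf_contactGauge (i : Fin N) (z : Φ.good) :
    collisionTimesOf G ε (fun t => Φ.flow t (z : Config N d X)) i =
      {t | contactGauge G ε i (fun k => (Φ.flow t (z : Config N d X) k).1) = 0} := by
  ext t
  rw [mem_collisionTimesOf, mem_setOf_eq]
  exact (contactGauge_eq_zero_iff ((Φ.isTrajectory (z : Config N d X) z.2).mem t) i).symm

/-- **The `n`-th collision time of `i` is measurable on the good set** (continuous separation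
distance, measurable separation map): induction on `n` with the hitting-time lemma applied to the
gauge of the orbit, continuous in time and measurable in the datum. [folklore] -/
theorem measurable_nthCollisionTimeOf_comp_subtype
    (hGc : Continuous fun p : X × X => ‖G.sepVec p.1 p.2‖)
    (hGm : Measurable fun p : X × X => G.sepVec p.1 p.2) (i : Fin N) (n : ℕ) :
    Measurable fun z : Φ.good => Φ.nthCollisionTimeOf i n (z : Config N d X) := by
  have hc : ∀ z : Φ.good, Continuous fun t =>
      contactGauge G ε i fun k => (Φ.flow t (z : Config N d X) k).1 := fun z =>
    (continuous_contactGauge hGc i).comp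
      (continuous_pi fun k => (Φ.isTrajectory (z : Config N d X) z.2).pos_continuous k)
  have hm : ∀ t, Measurable fun z : Φ.good =>
      contactGauge G ε i fun k => (Φ.flow t (z : Config N d X) k).1 := fun t =>
    (measurable_contactGauge hGm i).comp
      ((measurable_pi_lambda _ fun k => (measurable_pi_apply k).fst).comp
        ((Φ.measurable_flow t).comp measurable_subtype_coe))
  induction n with
  | zero =>
    have h : (fun z : Φ.good => Φ.nthCollisionTimeOf i 0 (z : Config N d X)) =
        fun z : Φ.good => nextTimeAfter
          {t | contactGauge G ε i (fun k => (Φ.flow t (z : Config N d X) k).1) = 0}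
          ((fun _ => (0 : ℝ)) z) := by
      funext z
      rw [← Φ.collisionTimesOf_eq_setOf_contactGauge i z]
      rfl
    rw [h]
    exact measurable_nextTimeAfter_setOf_eq_zero
      (f := fun (z : Φ.good) t => contactGauge G ε i fun k => (Φ.flow t (z : Config N d X) k).1)
      hc hm measurable_const
  | succ n ih =>
    have h : (fun z : Φ.good => Φ.nthCollisionTimeOf i (n + 1) (z : Config N d X)) =
        fun z : Φ.good => nextTimeAfter
          {t | contactGauge G ε i (fun k => (Φ.flow t (z : Config N d X) k).1) = 0}
          (Φ.nthCollisionTimeOf i n (z : Config N d X)) := by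
      funext z
      rw [← Φ.collisionTimesOf_eq_setOf_contactGauge i z]
      exact nthTimeAfter_succ _ _ _
    rw [h]
    exact measurable_nextTimeAfter_setOf_eq_zero
      (f := fun (z : Φ.good) t => contactGauge G ε i fun k => (Φ.flow t (z : Config N d X) k).1)
      hc hm ih

/-- **The configuration at the `n`-th collision time of `i` is measurable on the good set**
(joint measurability of the flow on `good × ℝ`: metrizable second-countable Borel position space,
continuous translations). [folklore] -/
theorem measurable_flow_nthCollisionTimeOf_comp_subtype [TopologicalSpace.PseudoMetrizableSpace X]
    [SecondCountableTopology X] [BorelSpace X] (hGt : ∀ x : X, Continuous (G.translate x))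
    (hGc : Continuous fun p : X × X => ‖G.sepVec p.1 p.2‖)
    (hGm : Measurable fun p : X × X => G.sepVec p.1 p.2) (i : Fin N) (n : ℕ) :
    Measurable fun z : Φ.good =>
      Φ.flow (Φ.nthCollisionTimeOf i n (z : Config N d X)) (z : Config N d X) :=
  (Φ.measurable_flow_prod hGt).comp
    (measurable_id.prodMk (Φ.measurable_nthCollisionTimeOf_comp_subtype hGc hGm i n))

/-- **"`i` has at least `n + 1` collisions in `(0, h]`" is a measurable event on the good set**
(chain form `0 < t_0 < ⋯ < t_n ≤ h` of `HardSphereFlow.lt_ncard_collisionTimesOf_window_iff_chain`).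
[folklore] -/
theorem measurableSet_lt_ncard_collisionTimesOf_window
    (hGc : Continuous fun p : X × X => ‖G.sepVec p.1 p.2‖)
    (hGm : Measurable fun p : X × X => G.sepVec p.1 p.2) (i : Fin N) (h : ℝ) (n : ℕ) :
    MeasurableSet {z : Φ.good |
      n < (collisionTimesOf G ε (fun s => Φ.flow s (z : Config N d X)) i ∩ Ioc 0 h).ncard} := by
  have hT : ∀ m, Measurable fun z : Φ.good => Φ.nthCollisionTimeOf i m (z : Config N d X) :=
    fun m => Φ.measurable_nthCollisionTimeOf_comp_subtype hGc hGm i m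
  have hset : {z : Φ.good |
      n < (collisionTimesOf G ε (fun s => Φ.flow s (z : Config N d X)) i ∩ Ioc 0 h).ncard} =
      ({z : Φ.good | 0 < Φ.nthCollisionTimeOf i 0 (z : Config N d X)} ∩
        ⋂ k ∈ Finset.range n, {z : Φ.good | Φ.nthCollisionTimeOf i k (z : Config N d X) <
          Φ.nthCollisionTimeOf i (k + 1) (z : Config N d X)}) ∩
        {z : Φ.good | Φ.nthCollisionTimeOf i n (z : Config N d X) ≤ h} := by
    ext z
    simp only [mem_setOf_eq, mem_inter_iff, mem_iInter, Finset.mem_range]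
    rw [Φ.lt_ncard_collisionTimesOf_window_iff_chain z.2 i h n]
    tauto
  rw [hset]
  exact ((measurableSet_lt measurable_const (hT 0)).inter
    (Finset.measurableSet_biInter _ fun k _ => measurableSet_lt (hT k) (hT (k + 1)))).inter
    (measurableSet_le (hT n) measurable_const)

/-- **Clamped collision sums are measurable on the good set**: for a per-(configuration, particle)
functional `F` measurable in the configuration, the sum over particles `i` and indices `n ≤ K` with
`n < Jᵢ` (number of collisions of `i` in `(0, h]`) of `F` at the configuration of the `n`-th collision
of `i` is a measurable function on the good set. [folklore] -/
theorem measurable_sum_ite_lt_ncard_comp_subtype [TopologicalSpace.PseudoMetrizableSpace X]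
    [SecondCountableTopology X] [BorelSpace X] (hGt : ∀ x : X, Continuous (G.translate x))
    (hGc : Continuous fun p : X × X => ‖G.sepVec p.1 p.2‖)
    (hGm : Measurable fun p : X × X => G.sepVec p.1 p.2) {F : Config N d X → Fin N → ℝ}
    (hF : ∀ i, Measurable fun ζ => F ζ i) (K : ℕ) (h : ℝ) :
    Measurable fun z : Φ.good => ∑ i, ∑ n ∈ Finset.range (K + 1),
      (if n < (collisionTimesOf G ε (fun s => Φ.flow s (z : Config N d X)) i ∩ Ioc 0 h).ncard then
        F (Φ.flow (Φ.nthCollisionTimeOf i n (z : Config N d X)) (z : Config N d X)) i else 0) := by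
  classical
  refine Finset.measurable_sum _ fun i _ => Finset.measurable_sum _ fun n _ => ?_
  exact Measurable.ite (Φ.measurableSet_lt_ncard_collisionTimesOf_window hGc hGm i h n)
    ((hF i).comp (Φ.measurable_flow_nthCollisionTimeOf_comp_subtype hGt hGc hGm i n))
    measurable_const

end HardSphereFlow

end Kinetic

/-! ## The flat torus -/

section TorusGeometry

variable {d : Type*} [Fintype d] {N : ℕ} {ε : ℝ}

/-- On `𝕋^d`: clamped collision sums of a functional measurable in the configuration are measurable
on the good set (all side conditions hold for the flat torus: continuous translations and
minimal-image distance, measurable separation map). [folklore] -/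
theorem HardSphereFlow.measurable_sum_ite_lt_ncard_comp_subtype_torus
    (Φ : HardSphereFlow (Torus.geometry d) ε N) {F : Config N d (UnitAddTorus d) → Fin N → ℝ}
    (hF : ∀ i, Measurable fun ζ => F ζ i) (K : ℕ) (h : ℝ) :
    Measurable fun z : Φ.good => ∑ i, ∑ n ∈ Finset.range (K + 1),
      (if n < (collisionTimesOf (Torus.geometry d) ε
          (fun s => Φ.flow s (z : Config N d (UnitAddTorus d))) i ∩ Ioc 0 h).ncard then
        F (Φ.flow (Φ.nthCollisionTimeOf i n (z : Config N d (UnitAddTorus d)))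
          (z : Config N d (UnitAddTorus d))) i else 0) :=
  Φ.measurable_sum_ite_lt_ncard_comp_subtype
    (fun x => (continuous_const.add FunctionSpaces.Torus.continuous_proj :
      Continuous fun v : EuclideanSpace ℝ d => x + FunctionSpaces.Torus.proj v))
    (Torus.continuous_norm_reprSym.comp (continuous_fst.sub continuous_snd))
    Torus.measurable_geometry_sepVec hF K h

end TorusGeometry

end

end Literature.Analysis.FluidPDE
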